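import Mathlib.Analysis.MeanInequalities
import Mathlib.Data.ENNReal.Real
import HarnessLib

/-!
# Route `BECDyadicChaining`, crux `BaseCoherentMass` (stmt-AtomisticToContinuum-13193),
# line registered (`Lines/birth.lean`): the registered stub `stub_cellLedger`

Supports (does not close) stmt-AtomisticToContinuum-13193; stub `stub_cellLedger` of the birth line
— the pure bookkeeping behind the cell method of the Lieb–Yngvason lower bound
[LSSY2005, (2.52)–(2.57)]: no physics, no measure theory, finite sums in `ℝ≥0∞`.

**The cell-occupation ledger.** Weights `w s` (`Σ_s w s = 1`) on assignments `s ∈ S` of `N`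
particles to cells `i ∈ ι`, occupation numbers `n s i` with `Σ_i n s i = N`, cell energies `E`
with the box bound `E k ≥ c k (k-1)` for `k ≤ p` and superadditivity `E (q p + r) ≥ q E p`, and
the budget `Σ_s w s Σ_i E (n s i) ≤ c B`. With a threshold `T`, `2T + 1 ≤ p`, split the expected
occupation of each cell `Σ_s w s n s i = m i + o i` into the moderately occupied part
`m i = Σ_s w s n s i 1[n s i ≤ T]` and the over-occupied part `o i = Σ_s w s n s i 1[T < n s i]`.
Then `Σ_i (m i + o i) = N` and `T Σ_i o i + Σ_i (m i)² ≤ B + N`.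

Proof. Pointwise in `k = n s i` (`pointwise_le`):
`c (k² 1[k ≤ T] + T k 1[T < k]) ≤ E k + c k 1[k ≤ T]` — for `k ≤ T` it is `c k² = c k(k-1) + c k`
and the box bound; for `T < k ≤ p` it is `c T k ≤ c k (k-1) ≤ E k`; for `p < k = q p + r`
(`q ≥ 1`, `r < p`) it is `c T k ≤ c T (2 q p) ≤ q c p (p-1) ≤ q E p ≤ E k` (superadditivity,
`2T ≤ p - 1`), the case split of `affine_lowerBound_of_box_of_superadditive` in
`Literature/MathematicalPhysics/QuantumManyBody/LiebYngvasonLowerBoundAssembly.lean`. Multiplying by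
`w s` and summing, the budget and `Σ_i m i ≤ N` give, after cancelling `c > 0`,
`Σ_i (A i + T o i) ≤ B + N` with `A i = Σ_s w s (n s i)² 1[n s i ≤ T]`; finally
`(m i)² ≤ (Σ_s w s) A i = A i` is the weighted Cauchy–Schwarz (Jensen) inequality
(`sq_sum_mul_le`, from `ENNReal.inner_le_weight_mul_Lp_of_nonneg` with exponent `2`).

## References

* [LSSY2005] E. H. Lieb, R. Seiringer, J. P. Solovej, J. Yngvason, *The Mathematics of the Bose
  Gas and its Condensation*, Oberwolfach Seminars 34, Birkhäuser 2005, (2.52)–(2.57).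
-/

noncomputable section

open scoped ENNReal BigOperators

namespace Summit.AtomisticToContinuum.BoseEinsteinCondensation.Theorems.BaseCoherentMass

namespace CellLedger

/-- **Weighted Cauchy–Schwarz (Jensen for the square) in `ℝ≥0∞`.**
`(Σ_i w i f i)² ≤ (Σ_i w i) Σ_i w i (f i)²`, the case `p = 2` of the weighted Hölder inequality
`ENNReal.inner_le_weight_mul_Lp_of_nonneg`, squared. [folklore] -/
theorem sq_sum_mul_le {S : Type*} (s : Finset S) (w f : S → ℝ≥0∞) :
    (∑ i ∈ s, w i * f i) ^ 2 ≤ (∑ i ∈ s, w i) * ∑ i ∈ s, w i * f i ^ 2 := by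
  have h := ENNReal.inner_le_weight_mul_Lp_of_nonneg s (by norm_num : (1 : ℝ) ≤ 2) w f
  have h2 : (1 : ℝ) - 2⁻¹ = 2⁻¹ := by norm_num
  rw [h2] at h
  calc (∑ i ∈ s, w i * f i) ^ 2
      ≤ ((∑ i ∈ s, w i) ^ (2⁻¹ : ℝ) * (∑ i ∈ s, w i * f i ^ (2 : ℝ)) ^ (2⁻¹ : ℝ)) ^ 2 := by
        gcongr
    _ = (∑ i ∈ s, w i) * ∑ i ∈ s, w i * f i ^ 2 := by
        rw [mul_pow, ← ENNReal.rpow_two, ← ENNReal.rpow_two, ENNReal.rpow_inv_rpow two_ne_zero,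
          ENNReal.rpow_inv_rpow two_ne_zero]
        simp_rw [ENNReal.rpow_two]

/-- **The pointwise ledger inequality.** If `E k ≥ c k (k-1)` for `k ≤ p` (box bound),
`E (q p + r) ≥ q E p` (superadditivity), `0 ≤ c` and `2T + 1 ≤ p`, then for every `k`:
`c · (k² if k ≤ T, else T k) ≤ E k + c · (k if k ≤ T, else 0)`. Cases `k ≤ T` (complete
`k² = k(k-1) + k`), `T < k ≤ p` (`T ≤ k - 1`), `p < k = qp + r` (`k ≤ 2qp`, `2T ≤ p - 1`).
[cite: LSSY2005, (2.53)–(2.57)] -/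
theorem pointwise_le {E : ℕ → ℝ≥0∞} {c : ℝ} (hc : 0 ≤ c) {p T : ℕ} (hT : 2 * T + 1 ≤ p)
    (hbox : ∀ k : ℕ, k ≤ p → ENNReal.ofReal (c * k * (k - 1)) ≤ E k)
    (hsup : ∀ q r : ℕ, (q : ℝ≥0∞) * E p ≤ E (q * p + r)) (k : ℕ) :
    ENNReal.ofReal c * (if k ≤ T then (k : ℝ≥0∞) ^ 2 else (T : ℝ≥0∞) * k) ≤
      E k + ENNReal.ofReal c * (if k ≤ T then (k : ℝ≥0∞) else 0) := by
  split_ifs with hk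
  · -- `k ≤ T ≤ p`: `c k² = c k (k-1) + c k`
    have hkp : k ≤ p := by omega
    calc ENNReal.ofReal c * (k : ℝ≥0∞) ^ 2 = ENNReal.ofReal (c * k * (k - 1) + c * k) := by
          rw [← ENNReal.ofReal_natCast k, ← ENNReal.ofReal_pow (Nat.cast_nonneg k),
            ← ENNReal.ofReal_mul hc]
          congr 1
          ring
      _ ≤ ENNReal.ofReal (c * k * (k - 1)) + ENNReal.ofReal (c * k) := ENNReal.ofReal_add_le
      _ ≤ E k + ENNReal.ofReal c * k := by
          gcongr
          · exact hbox k hkp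
          · rw [ENNReal.ofReal_mul hc, ENNReal.ofReal_natCast]
  · -- `T < k`: the right-hand side is `E k`
    rw [mul_zero, add_zero]
    rw [not_le] at hk
    have hTk : ENNReal.ofReal c * ((T : ℝ≥0∞) * k) = ENNReal.ofReal (c * T * k) := by
      rw [ENNReal.ofReal_mul (mul_nonneg hc (Nat.cast_nonneg T)), ENNReal.ofReal_mul hc,
        ENNReal.ofReal_natCast, ENNReal.ofReal_natCast, mul_assoc]
    rw [hTk]
    rcases le_or_gt k p with hkp | hkp
    · -- `T < k ≤ p`: `c T k ≤ c k (k-1) ≤ E k`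
      calc ENNReal.ofReal (c * T * k) ≤ ENNReal.ofReal (c * k * (k - 1)) := by
            apply ENNReal.ofReal_le_ofReal
            have h1 : (T : ℝ) ≤ k - 1 := by
              have : (T : ℝ) + 1 ≤ k := by exact_mod_cast hk
              linarith
            have h2 : 0 ≤ c * k := mul_nonneg hc (Nat.cast_nonneg k)
            nlinarith
        _ ≤ E k := hbox k hkp
    · -- `p < k`: `k = qp + r`, `q ≥ 1`, `r < p`, so `k ≤ 2qp`, and `2T ≤ p - 1`
      have hp1 : 1 ≤ p := by omega
      have hp0 : 0 < p := hp1
      set q := k / p with hq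
      set r := k % p with hr
      have hkqr : q * p + r = k := Nat.div_add_mod' k p
      have hq1 : 1 ≤ q := (Nat.one_le_div_iff hp0).2 hkp.le
      have h2q : (k : ℝ) ≤ 2 * (q * p) := by
        have h1 : k < q * p + p := by
          have := Nat.mod_lt k hp0
          omega
        have h2 : q * p + p ≤ 2 * (q * p) := by nlinarith
        exact_mod_cast (h1.trans_le h2).le
      have hTp : 2 * (T : ℝ) ≤ (p : ℝ) - 1 := by
        have : ((2 * T + 1 : ℕ) : ℝ) ≤ p := by exact_mod_cast hT
        push_cast at this
        linarith
      have hkey : c * T * k ≤ q * (c * p * (p - 1)) := by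
        calc c * T * k ≤ c * T * (2 * (q * p)) :=
              mul_le_mul_of_nonneg_left h2q (mul_nonneg hc (Nat.cast_nonneg T))
          _ = q * (c * p * (2 * T)) := by ring
          _ ≤ q * (c * p * (p - 1)) :=
              mul_le_mul_of_nonneg_left (mul_le_mul_of_nonneg_left hTp
                (mul_nonneg hc (Nat.cast_nonneg p))) (Nat.cast_nonneg q)
      calc ENNReal.ofReal (c * T * k)
          ≤ ENNReal.ofReal (q * (c * p * (p - 1))) := ENNReal.ofReal_le_ofReal hkey
        _ = (q : ℝ≥0∞) * ENNReal.ofReal (c * p * (p - 1)) := by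
            rw [ENNReal.ofReal_mul (Nat.cast_nonneg _), ENNReal.ofReal_natCast]
        _ ≤ (q : ℝ≥0∞) * E p := by gcongr; exact hbox p le_rfl
        _ ≤ E (q * p + r) := hsup q r
        _ = E k := by rw [hkqr]

end CellLedger

/-! ### The stub -/

open CellLedger in
/-- **Stub `stub_cellLedger` — the cell-occupation ledger (pure bookkeeping behind LSSY
(2.52)–(2.57)).** Weights `w` on assignments `s` (probabilities of the particle-to-cell
configurations), occupation numbers `n s i` summing to `N`, cell energies `E` with the box bound
`E k ≥ c k(k-1)` for `k ≤ p` and superadditivity `E(qp + r) ≥ q E(p)`, and the budget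
`Σ_s w_s Σ_i E(n s i) ≤ c B`. Then, with threshold `T` (`2T + 1 ≤ p`), splitting each cell's
expected occupation into the moderately occupied part `m_i` (`n ≤ T`, whose weighted square is
controlled, Cauchy–Schwarz) and the over-occupied part `o_i` (`n > T`, controlled linearly:
`E k ≥ c T k` for `k > T`): `T Σ o + Σ m² ≤ B + N`. [cite: LSSY2005, (2.52)–(2.57)] -/
theorem stub_cellLedger : ∀ {ι S : Type} [Fintype ι] [Fintype S] (w : S → ℝ≥0∞) (_hw : ∑ s, w s = 1)
    (n : S → ι → ℕ) (N : ℕ) (_hn : ∀ s, ∑ i, n s i = N) (E : ℕ → ℝ≥0∞) (c : ℝ) (_hc : 0 < c)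
    (p T : ℕ) (_hT : 2 * T + 1 ≤ p)
    (_hbox : ∀ k : ℕ, k ≤ p → ENNReal.ofReal (c * k * (k - 1)) ≤ E k)
    (_hsup : ∀ q r : ℕ, (q : ℝ≥0∞) * E p ≤ E (q * p + r))
    (B : ℝ) (_hB : 0 ≤ B) (_hbudget : ∑ s, w s * ∑ i, E (n s i) ≤ ENNReal.ofReal (c * B)),
    ∃ m o : ι → ℝ≥0∞, (∀ i, ∑ s, w s * (n s i : ℝ≥0∞) = m i + o i) ∧
      (∑ i, (m i + o i)) = (N : ℝ≥0∞) ∧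
      (T : ℝ≥0∞) * ∑ i, o i + ∑ i, m i ^ 2 ≤ ENNReal.ofReal B + N := by
  intro ι S _ _ w hw n N hn E c hc p T hT hbox hsup B _hB hbudget
  -- the truncated occupations, cell by cell and assignment by assignment
  obtain ⟨f, hf⟩ : ∃ f : ι → S → ℝ≥0∞, ∀ i s,
      f i s = if n s i ≤ T then (n s i : ℝ≥0∞) else 0 := ⟨_, fun _ _ => rfl⟩
  obtain ⟨g, hg⟩ : ∃ g : ι → S → ℝ≥0∞, ∀ i s,
      g i s = if n s i ≤ T then 0 else (n s i : ℝ≥0∞) := ⟨_, fun _ _ => rfl⟩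
  obtain ⟨m, hm⟩ : ∃ m : ι → ℝ≥0∞, ∀ i, m i = ∑ s, w s * f i s := ⟨_, fun _ => rfl⟩
  obtain ⟨o, ho⟩ : ∃ o : ι → ℝ≥0∞, ∀ i, o i = ∑ s, w s * g i s := ⟨_, fun _ => rfl⟩
  -- (a) the split of each cell's expected occupation
  have ha : ∀ i, ∑ s, w s * (n s i : ℝ≥0∞) = m i + o i := by
    intro i
    rw [hm, ho, ← Finset.sum_add_distrib]
    refine Finset.sum_congr rfl fun s _ => ?_
    rw [← mul_add, hf, hg]
    split_ifs <;> simp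
  -- (b) the total expected occupation is `N`
  have hb : ∑ i, (m i + o i) = (N : ℝ≥0∞) := by
    calc ∑ i, (m i + o i) = ∑ i, ∑ s, w s * (n s i : ℝ≥0∞) :=
          Finset.sum_congr rfl fun i _ => (ha i).symm
      _ = ∑ s, w s * ((∑ i, n s i : ℕ) : ℝ≥0∞) := by
          rw [Finset.sum_comm]
          simp_rw [Nat.cast_sum, Finset.mul_sum]
      _ = N := by simp_rw [hn, ← Finset.sum_mul, hw, one_mul]
  have hmN : ∑ i, m i ≤ N :=
    calc ∑ i, m i ≤ ∑ i, (m i + o i) := Finset.sum_le_sum fun i _ => le_self_add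
      _ = N := hb
  -- (c) the summed pointwise inequality, `c` cancelled: `Σ_i (A i + T o i) ≤ B + N`
  have hsum : ∑ i, (∑ s, w s * f i s ^ 2 + (T : ℝ≥0∞) * o i) ≤ ENNReal.ofReal B + N := by
    have hc0 : ENNReal.ofReal c ≠ 0 := (ENNReal.ofReal_pos.2 hc).ne'
    refine (ENNReal.mul_le_mul_iff_right hc0 ENNReal.ofReal_ne_top).1 ?_
    calc ENNReal.ofReal c * ∑ i, (∑ s, w s * f i s ^ 2 + (T : ℝ≥0∞) * o i)
        = ∑ i, ∑ s, w s * (ENNReal.ofReal c *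
            (if n s i ≤ T then (n s i : ℝ≥0∞) ^ 2 else (T : ℝ≥0∞) * n s i)) := by
          rw [Finset.mul_sum]
          refine Finset.sum_congr rfl fun i _ => ?_
          rw [ho, Finset.mul_sum, ← Finset.sum_add_distrib, Finset.mul_sum]
          refine Finset.sum_congr rfl fun s _ => ?_
          rw [hf, hg]
          split_ifs <;> ring
      _ ≤ ∑ i, ∑ s, w s * (E (n s i) + ENNReal.ofReal c *
            (if n s i ≤ T then (n s i : ℝ≥0∞) else 0)) := by
          gcongr with i _ s _
          exact pointwise_le hc.le hT hbox hsup (n s i)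
      _ = ∑ s, w s * ∑ i, E (n s i) + ENNReal.ofReal c * ∑ i, m i := by
          simp_rw [mul_add, Finset.sum_add_distrib]
          congr 1
          · rw [Finset.sum_comm]
            simp_rw [Finset.mul_sum]
          · rw [Finset.mul_sum]
            refine Finset.sum_congr rfl fun i _ => ?_
            rw [hm, Finset.mul_sum]
            refine Finset.sum_congr rfl fun s _ => ?_
            rw [hf]
            ring
      _ ≤ ENNReal.ofReal (c * B) + ENNReal.ofReal c * N := by gcongr
      _ = ENNReal.ofReal c * (ENNReal.ofReal B + N) := by rw [mul_add, ENNReal.ofReal_mul hc.le]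
  -- Cauchy–Schwarz per cell: `(m i)² ≤ (Σ_s w s) A i = A i`
  have hCS : ∀ i, m i ^ 2 ≤ ∑ s, w s * f i s ^ 2 := fun i => by
    rw [hm]
    calc (∑ s, w s * f i s) ^ 2 ≤ (∑ s, w s) * ∑ s, w s * f i s ^ 2 := sq_sum_mul_le _ _ _
      _ = ∑ s, w s * f i s ^ 2 := by rw [hw, one_mul]
  refine ⟨m, o, ha, hb, ?_⟩
  calc (T : ℝ≥0∞) * ∑ i, o i + ∑ i, m i ^ 2
      ≤ (T : ℝ≥0∞) * ∑ i, o i + ∑ i, ∑ s, w s * f i s ^ 2 := by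
        gcongr with i _
        exact hCS i
    _ = ∑ i, (∑ s, w s * f i s ^ 2 + (T : ℝ≥0∞) * o i) := by
        rw [add_comm, Finset.mul_sum, Finset.sum_add_distrib]
    _ ≤ ENNReal.ofReal B + N := hsum

end Summit.AtomisticToContinuum.BoseEinsteinCondensation.Theorems.BaseCoherentMass

end
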